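import Summits.Ventures.PercRepro2.CaseOneGadgetUWOBMainIIT
import Summits.Ventures.PercRepro2.CaseOneGadgetUWOBMainIT
import Summits.Ventures.PercRepro2.CaseOneStarMainT
import Summits.Ventures.PercRepro2.CaseOneCore

/-!
# The gadget `u ~ {w, o, b}`, `w ~ {u, a₁, a₂}` is an anchor of the six-form calculus
(blind cell PercRepro2, p1 g32; the last four-form anchor gets its six-form twin)

With `(ii-T)` / `(i-T)` at `u` for the gadget (`zSplitIIT_of_gadgetUWOB` / `zSplitIT_of_gadgetUWOB`,
`CaseOneGadgetUWOBMainIIT` / `MainIT`) next to its four forms (`fourForms_of_gadgetUWOBAnchor`):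
**`sixForms_of_gadgetUWOB`**, **`closedAtT_of_gadgetUWOB`** (the gadget is six-form closed for every
weight vector), **`closedAtT_of_gadgetUWOBAnchor`**, and — since the marked star (`closedAtT_of_markedStar`)
and the other anchors (`closedAtT_of_closedAnchorT`) are six-form closed already —
**`closedAtT_of_closedAnchor`**: EVERY closed anchor of the four-form calculus (a mark, a marked star,
a uwob gadget, a roots-only vertex, a roots-and-`o` vertex) is six-form closed. Hence the `a₂`-free
residual core relative to the full anchor set, `InCoreTU`, and the reductions `closedAtT_of_coreTU` /
`closedAt_of_coreTU`: the six (hence the four) forms everywhere from the six forms on `InCoreTU`. The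
four-form moves are moves of the lane (`MovesQ.of_moves`), so `InCoreTU` lies inside the four-form core
`InCore` with the `a₂`-edges at the statement vertex removed (`InCore.of_inCoreTU`): the six-form
calculus dominates the four-form one outright. Own code; standard axioms. -/

namespace Summit.Ventures.PercRepro2

namespace CaseOne

universe u

section GadgetT
variable {V : Type*} {E : Type*} [Fintype E] [DecidableEq E] [Fintype V] [DecidableEq V]
  {R : Type*} [Field R] [LinearOrder R] [IsStrictOrderedRing R]
variable {ends : E → Sym2 V} {o a₁ a₂ b u w : V} {euw euo eub ewa1 ewa2 : E}

/-- **The six forms at `u` for the gadget `u ~ {w, o, b}`, `w ~ {u, a₁, a₂}`**, every finite graph,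
every weight vector: the four forms of `fourForms_of_gadgetUWOBAnchor` and the two T-world forms. -/
theorem sixForms_of_gadgetUWOB (p : E → R) (hp : IsProbVec p)
    (h : IsGadgetUWOB ends o a₁ a₂ b u w euw euo eub ewa1 ewa2) : SixForms p ends o a₁ a₂ u b := by
  obtain ⟨k1, k2, k3, k4⟩ :=
    fourForms_of_gadgetUWOBAnchor o a₁ a₂ b E ends p hp u ⟨w, euw, euo, eub, ewa1, ewa2, h⟩
  exact ⟨k1, k2, zSplitIIT_of_gadgetUWOB p hp h, k3, k4, zSplitIT_of_gadgetUWOB p hp h⟩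

/-- **The uwob gadget is an anchor of the six-form calculus**: the six forms for every weight vector. -/
theorem closedAtT_of_gadgetUWOB (h : IsGadgetUWOB ends o a₁ a₂ b u w euw euo eub ewa1 ewa2) :
    ClosedAtT (R := R) o a₁ a₂ b E ends u :=
  fun p hp => sixForms_of_gadgetUWOB p hp h

end GadgetT

section AnchorsTU
variable {V : Type*} (o a₁ a₂ b : V) [Fintype V] [DecidableEq V] {R : Type*} [Field R] [LinearOrder R]
  [IsStrictOrderedRing R]

/-- **A uwob-gadget anchor is six-form closed.** -/
theorem closedAtT_of_gadgetUWOBAnchor (E : Type u) [Fintype E] [DecidableEq E] (ends : E → Sym2 V)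
    (v : V) (h : GadgetUWOBAnchor o a₁ a₂ b E ends v) : ClosedAtT (R := R) o a₁ a₂ b E ends v := by
  obtain ⟨w, euw, euo, eub, ewa1, ewa2, h⟩ := h
  exact closedAtT_of_gadgetUWOB h

/-- **Every closed anchor of the four-form calculus is six-form closed**: a mark, a marked star, a uwob
gadget, a roots-only vertex, a roots-and-`o` vertex. -/
theorem closedAtT_of_closedAnchor (E : Type u) [Fintype E] [DecidableEq E] (ends : E → Sym2 V)
    (v : V) (h : ClosedAnchor o a₁ a₂ b E ends v) : ClosedAtT (R := R) o a₁ a₂ b E ends v := by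
  rcases h with h | h | h | h | h
  · exact closedAtT_of_closedAnchorTS o a₁ a₂ b E ends v (Or.inl (Or.inl h))
  · exact closedAtT_of_closedAnchorTS o a₁ a₂ b E ends v (Or.inr h)
  · exact closedAtT_of_gadgetUWOBAnchor o a₁ a₂ b E ends v h
  · exact closedAtT_of_closedAnchorTS o a₁ a₂ b E ends v (Or.inl (Or.inr (Or.inl h)))
  · exact closedAtT_of_closedAnchorTS o a₁ a₂ b E ends v (Or.inl (Or.inr (Or.inr h)))

variable (v : V)

/-- **The `a₂`-free residual core relative to the full anchor set `ClosedAnchor`**: residual for `v`, no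
edge `{a₂, v}`, not reachable by the moves of the lane from any closed anchor of the four-form calculus. -/
def InCoreTU (E : Type u) [Fintype E] [DecidableEq E] (ends : E → Sym2 V) : Prop :=
  InCoreTAnc o a₁ a₂ b v (fun E₀ _ _ ends₀ v₀ => ClosedAnchor o a₁ a₂ b E₀ ends₀ v₀) E ends

/-- **The reduction to the `a₂`-free residual core relative to every closed anchor**: the six forms for
every weight vector on every `InCoreTU` instance give them on every finite graph. -/
theorem closedAtT_of_coreTU
    (hcore : ∀ (E' : Type u) [Fintype E'] [DecidableEq E'] (ends' : E' → Sym2 V),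
      InCoreTU o a₁ a₂ b v E' ends' → ClosedAtT (R := R) o a₁ a₂ b E' ends' v) :
    ∀ (E : Type u) [Fintype E] [DecidableEq E] (ends : E → Sym2 V),
      ClosedAtT (R := R) o a₁ a₂ b E ends v :=
  closedAtT_of_coreTAnc o a₁ a₂ b v _
    (fun E₀ _ _ ends₀ v₀ h => closedAtT_of_closedAnchor o a₁ a₂ b E₀ ends₀ v₀ h) hcore

/-- **The four forms everywhere from the six forms on the `a₂`-free residual core `InCoreTU`.** -/
theorem closedAt_of_coreTU
    (hcore : ∀ (E' : Type u) [Fintype E'] [DecidableEq E'] (ends' : E' → Sym2 V),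
      InCoreTU o a₁ a₂ b v E' ends' → ClosedAtT (R := R) o a₁ a₂ b E' ends' v)
    (E : Type u) [Fintype E] [DecidableEq E] (ends : E → Sym2 V) : ClosedAt R o a₁ a₂ b E ends v :=
  closedAt_of_closedAtT (closedAtT_of_coreTU o a₁ a₂ b v hcore E ends)

end AnchorsTU

section CoreCompare
variable {V : Type*} {o a₁ a₂ b : V}

/-- Every sequence of four-form moves is a sequence of moves of the lane. -/
theorem MovesQ.of_moves {E' : Type u} [Fintype E'] [DecidableEq E'] {ends' : E' → Sym2 V} {v' : V}
    {E : Type u} [Fintype E] [DecidableEq E] {ends : E → Sym2 V} {v : V}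
    (h : Moves o a₁ a₂ b E' ends' v' E ends v) : MovesQ o a₁ a₂ b E' ends' v' E ends v := by
  induction h with
  | refl => exact MovesQ.refl _ _ _
  | tail _ hstep ih => exact MovesQ.tail ih (MoveStepQ.move hstep)

variable (o a₁ a₂ b : V) (v : V)

/-- **The `a₂`-free residual core of the six-form calculus lies in the four-form core**: an `InCoreTU`
instance is an `InCore` instance with no edge `{a₂, v}`. -/
theorem InCore.of_inCoreTU (E : Type u) [Fintype E] [DecidableEq E] (ends : E → Sym2 V)
    (h : InCoreTU o a₁ a₂ b v E ends) : InCore o a₁ a₂ b v E ends ∧ ∀ e, ends e ≠ s(a₂, v) := by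
  obtain ⟨hres, ha2, hreach⟩ := h
  refine ⟨⟨hres, fun hr => hreach ?_⟩, ha2⟩
  obtain ⟨E₀, _, _, ends₀, v₀, hanc, hmv⟩ := hr
  exact ⟨E₀, inferInstance, inferInstance, ends₀, v₀, hanc, MovesQ.of_moves hmv⟩

end CoreCompare

end CaseOne

end Summit.Ventures.PercRepro2
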